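import Literature.Topology.FourManifolds.HandlebodyKernelExtensionGenusOne
import HarnessLib

/-!
# Faithfulness of the mapping class group of the torus on `π₁` (named fact), and genus one of
# Griffiths' handlebody extension theorem

Topic `Literature/Topology/FourManifolds`; fifth file on the named fact
`Literature.Topology.FourManifolds.GriffithsExtension` (`HandlebodyKernelExtension.lean`;
H. B. Griffiths, *Automorphisms of a 3-dimensional handlebody* (1964), main theorem), after
`HandlebodyKernelExtensionGenusOne.lean`, which proves the genus-`1` clause of the fact from the
hypothesis (F) "a self-diffeomorphism of the Heegaard torus acting trivially on `π₁` is diffeotopic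
to the identity".  Here (F) is recorded as the NAMED FACT it is —

* `Literature.Topology.FourManifolds.TorusMappingClassFaithful` — **the kernel of
  `Mod^±(T²) → Aut π₁(T²) = GL(2, ℤ)` is trivial, smoothly**: for the boundary torus `∂H` of any
  genus-`1` handlebody `H` (any boundary datum), a self-diffeomorphism `φ` fixing a point `z` and
  inducing the identity of `π₁(∂H, z)` is diffeotopic to the identity.  B. Farb, D. Margalit,
  *A primer on mapping class groups* (2012), Thm. 2.5 ("the homomorphism
  `σ : Mod(T²) → SL(2, ℤ)` given by the action on `H₁(T²; ℤ) ≅ ℤ²` is an isomorphism" — here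
  its injectivity; `Mod` is the group of isotopy classes, Thm. 1.12 (Baer, Epstein: homotopic
  homeomorphisms of compact surfaces are isotopic), and §1.4.2 with Thm. 1.13: isotopic
  diffeomorphisms are smoothly isotopic); D. B. A. Epstein, *Curves on 2-manifolds and isotopies*,
  Acta Math. 115 (1966), Thm. 6.4.  NOT proved here (a named fact, `def … : Prop`, D-0014); the
  surjectivity half of the same theorem is proved in the tree (`DehnNielsenBaerTorus.lean`,
  `RoundSolidTorusModel.exists_boundaryDiffeomorph_mapOfEq_eq`) —

and the genus-`1` clause of `GriffithsExtension` is derived from it: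

* `griffithsExtension_genus_one` — **granted `TorusMappingClassFaithful`, every self-diffeomorphism
  of the boundary of a genus-`1` handlebody satisfying Griffiths' kernel condition extends over the
  handlebody** (`griffithsExtension_genus_one_of_faithful` fed with the fact at the base point of
  the round solid torus);
* `griffithsExtension_of_torusMappingClassFaithful_of_flower` — `GriffithsExtension` from the fact
  and Griffiths' criterion on the flower handlebodies of genus `≥ 2`.

## References

* B. Farb, D. Margalit, *A primer on mapping class groups*, PMS 49 (2012), Thm. 2.5, Thm. 1.12,
  Thm. 1.13, §1.4.2. [FarbMargalit2012]
* D. B. A. Epstein, *Curves on 2-manifolds and isotopies*, Acta Math. 115 (1966), Thm. 6.4.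
  [Epstein1966]
* H. B. Griffiths, *Automorphisms of a 3-dimensional handlebody*, Abh. Math. Sem. Univ. Hamburg
  26 (1964) 191–210. [GriffithsHB1964Handlebody]
-/

noncomputable section

namespace Literature.Topology.FourManifolds

open Set Function
open scoped _root_.Manifold _root_.ContDiff _root_.Topology

/-- **Faithfulness of the mapping class group of the torus on the fundamental group** (the
injectivity half of the Dehn–Nielsen–Baer theorem in genus `1`, smooth form).  For a genus-`1`
handlebody `H` (`IsHandlebody 1 H`) with boundary datum `b` (`b.carrier ≅ ∂H ≅ T²`), every
self-diffeomorphism `φ` of `b.carrier` fixing a point `z` and inducing the identity of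
`π₁(b.carrier, z)` is diffeotopic to the identity (`Diffeomorph.IsDiffeotopicToId`: the time-`1`
stage of a diffeotopy).  B. Farb, D. Margalit, *A primer on mapping class groups* (2012),
Thm. 2.5: "The homomorphism `σ : Mod(T²) → SL(2, ℤ)` given by the action on `H₁(T²; ℤ) ≅ ℤ²` is
an isomorphism" — its injectivity (a homeomorphism acting trivially on `H₁(T²) = π₁(T²)` is
isotopic to the identity; `Mod(T²)` is the group of isotopy classes, cf. Thm. 1.12, Baer–Epstein:
homotopic homeomorphisms of a compact surface are isotopic), read smoothly by §1.4.2 / Thm. 1.13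
(isotopic diffeomorphisms are smoothly isotopic); D. B. A. Epstein, *Curves on 2-manifolds and
isotopies*, Acta Math. 115 (1966), Thm. 6.4.  (A `φ` acting trivially on `π₁(T²)` acts trivially
on `H₁`, in particular preserves orientation, so lies in `ker σ`.)  Stated, like
`DehnNielsenBaerSurfaceSmooth`, over the boundary data of genus-`1` handlebodies — the tree's smooth
tori; universe `0`.  Named fact (D-0014); users take `(h : TorusMappingClassFaithful)`.
-- TODO(general form): Baer–Epstein for all compact surfaces (homotopic diffeomorphisms are
-- diffeotopic); only the torus and the based `π₁`-trivial case are stated.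
[cite: FarbMargalit2012, Thm. 2.5 (injectivity), Thm. 1.12 and §1.4.2] [cite: Epstein1966, Thm. 6.4] -/
def TorusMappingClassFaithful : Prop :=
  ∀ (H : Type) [TopologicalSpace H] [T2Space H] [SecondCountableTopology H]
    [ChartedSpace (EuclideanHalfSpace 3) H] [IsManifold (𝓡∂ 3) ∞ H] (_ : IsHandlebody 1 H)
    (b : BoundaryData (𝓡∂ 3) H (𝓡 2)) (φ : b.carrier ≃ₘ⟮𝓡 2, 𝓡 2⟯ b.carrier) (z : b.carrier)
    (hz : φ z = z),
    (∀ γ : FundamentalGroup b.carrier z,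
      FundamentalGroup.mapOfEq (⟨φ, φ.continuous⟩ : C(b.carrier, b.carrier)) hz γ = γ) →
    Diffeomorph.IsDiffeotopicToId φ

open RoundSolidTorusModel in
/-- The fact at the base point of the round solid torus: hypothesis (F) of
`HandlebodyKernelExtensionGenusOne.lean`. [cite: FarbMargalit2012, Thm. 2.5] -/
theorem TorusMappingClassFaithful.roundSolidTorus (hF : TorusMappingClassFaithful)
    (τ : (𝓡∂ 3).boundary RoundSolidTorus ≃ₘ⟮𝓡 2, 𝓡 2⟯ (𝓡∂ 3).boundary RoundSolidTorus)
    (hτ : τ basePt = basePt)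
    (h : ∀ γ, FundamentalGroup.mapOfEq (⟨τ, τ.continuous⟩ : C(_, _)) hτ γ = γ) :
    Diffeomorph.IsDiffeotopicToId τ :=
  hF RoundSolidTorus isHandlebody_one_roundSolidTorus (BoundaryManifold.boundaryData 2 RoundSolidTorus)
    τ basePt hτ h

/-- **Griffiths' handlebody extension theorem in genus one, granted the faithfulness of `Mod(T²)`**
(the `g = 1` clause of `Literature.Topology.FourManifolds.GriffithsExtension`; Griffiths (1964),
main theorem; Hensel (2020), Cor. 5.11): for a genus-`1` handlebody `H` with any boundary datum `b`,
a self-diffeomorphism `ψ` of `b.carrier` whose induced map on `π₁(b.carrier, x₀)` carries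
`ker (π₁ ∂H → π₁ H)` onto the kernel at `ψ x₀` extends to a self-diffeomorphism of `H`.  Proof:
`griffithsExtension_genus_one_of_faithful` (normalise the base point by diffeotopies, realise the
kernel-preserving automorphism of `π₁(T²) ≅ ℤ²` — a lower-triangular matrix — by an extendable
linear diffeomorphism of the round solid torus, and absorb the `π₁`-trivial remainder by
`TorusMappingClassFaithful` and a collar). [cite: GriffithsHB1964Handlebody, main theorem (genus 1)] -/
theorem griffithsExtension_genus_one (hF : TorusMappingClassFaithful)
    (H : Type) [TopologicalSpace H] [T2Space H] [SecondCountableTopology H]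
    [ChartedSpace (EuclideanHalfSpace 3) H] [IsManifold (𝓡∂ 3) ∞ H]
    (hH : IsHandlebody 1 H) (b : BoundaryData (𝓡∂ 3) H (𝓡 2))
    (ψ : b.carrier ≃ₘ⟮𝓡 2, 𝓡 2⟯ b.carrier) (x₀ : b.carrier)
    (hker : ((FundamentalGroup.map (⟨b.incl, b.continuous_incl⟩ : C(b.carrier, H)) x₀).ker).map
        (FundamentalGroup.map (⟨ψ, ψ.continuous⟩ : C(b.carrier, b.carrier)) x₀)
      = (FundamentalGroup.map (⟨b.incl, b.continuous_incl⟩ : C(b.carrier, H))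
          ((⟨ψ, ψ.continuous⟩ : C(b.carrier, b.carrier)) x₀)).ker) :
    b.DiffeoExtends ψ :=
  griffithsExtension_genus_one_of_faithful hF.roundSolidTorus H hH b ψ x₀ hker

/-- **`GriffithsExtension` from `TorusMappingClassFaithful` and Griffiths' criterion on the flower
handlebodies of genus `≥ 2`** (`griffithsExtension_of_faithful_of_flower`): after this file the
genus-`≤ 1` part of the fact rests on the single named fact `TorusMappingClassFaithful`, and the
genus-`≥ 2` part on the kernel-extension criterion for `FlowerModel.FlowerHandlebody` (Dehn's lemma /
Dehn–Nielsen–Baer; Hensel (2020), Lemma 5.10, Cor. 5.11).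
[cite: Hensel2020HandlebodyPrimer, Cor. 5.11 and Lemma 5.10] -/
theorem griffithsExtension_of_torusMappingClassFaithful_of_flower (hF : TorusMappingClassFaithful)
    (h₂ : ∀ (g : ℕ) (hg : 2 ≤ g)
      (χ : (BoundaryManifold.boundaryData 2 (FlowerModel.FlowerHandlebody hg)).carrier ≃ₘ⟮𝓡 2, 𝓡 2⟯
        (BoundaryManifold.boundaryData 2 (FlowerModel.FlowerHandlebody hg)).carrier)
      (y₀ : (BoundaryManifold.boundaryData 2 (FlowerModel.FlowerHandlebody hg)).carrier),
      ((FundamentalGroup.map (⟨(BoundaryManifold.boundaryData 2 (FlowerModel.FlowerHandlebody hg)).incl,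
          (BoundaryManifold.boundaryData 2 (FlowerModel.FlowerHandlebody hg)).continuous_incl⟩ :
            C((BoundaryManifold.boundaryData 2 (FlowerModel.FlowerHandlebody hg)).carrier,
              FlowerModel.FlowerHandlebody hg)) y₀).ker).map
          (FundamentalGroup.map (⟨χ, χ.continuous⟩ : C(_, _)) y₀)
        = (FundamentalGroup.map (⟨(BoundaryManifold.boundaryData 2 (FlowerModel.FlowerHandlebody hg)).incl,
            (BoundaryManifold.boundaryData 2 (FlowerModel.FlowerHandlebody hg)).continuous_incl⟩ :
              C((BoundaryManifold.boundaryData 2 (FlowerModel.FlowerHandlebody hg)).carrier,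
                FlowerModel.FlowerHandlebody hg))
            ((⟨χ, χ.continuous⟩ : C(_, _)) y₀)).ker →
      (BoundaryManifold.boundaryData 2 (FlowerModel.FlowerHandlebody hg)).DiffeoExtends χ) :
    GriffithsExtension :=
  griffithsExtension_of_faithful_of_flower hF.roundSolidTorus h₂

end Literature.Topology.FourManifolds

end
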